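import Summits.QuantumFields.YangMills.Theorems.UnitScaleTiltHalvingP1FlatCoreTopDictionary
import Summits.QuantumFields.YangMills.Theorems.UnitScaleTiltHalvingP1FlatCoreFrameLinStar
import Literature.MathematicalPhysics.QuantumFieldTheory.Balaban1983to89.B8CubeMemberZd
import HarnessLib

/-!
# Line H (`BirthV10.stub_halvingStep`, stmt-QuantumFields-19200), J4c **(T4b) FILE 4: THE REPRESENTATIVE AND THE TARGET** — the two dictionary rows
# `hrep` and `th ∕ hth ∕ hthk ∕ hthlo ∕ ‖th‖` of block (D) of ✓`P1FlatCoreTopStepTorus.hFP_kLevel_top_RD`, discharged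

Cell `ym3-torus` (HUMAN RULING D-0037: YM₃ on T³ is ladder rung R3, NOT the Clay problem), width seat `ym-ust-19936-w8` gen 2.
`--supports stmt-QuantumFields-19200 --as helper`; THEOREMS ONLY (0 `def`, 0 `sorry`); count-neutral; nothing here claims `core′`, the stub, the crux or the gap.

WHAT.  The top step ✓`hFP_kLevel_top_RD` (block (D)) displays two pieces of bookkeeping that the (A-1) STAGE 2∕3 assembler must feed:
* `hrep : ∀ yc ∈ Λs k, ∀ x, InBox (tlo L yc k) (thi L yc k) x → rep (cover P x) = x` — the representative `rep` inverts the cover on every top tower box.  With the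
  door's representative `rep := fun s => lift P x₀ + rel x₀ s` (✓`P1FlatCoreChartDataDoor`, ✓`P1FlatCoreJunction`) this is §1: `lift_add_rel_cover_eq` (the left
  inverse on the symmetric window of `x₀`), ★`rep_cover_eq_of_mem_cube` (on N05's level-`0` window cube `cube L a M′ ρ′ k 0` under the door's `ha`∕`hroom`), and
  ★`hrep_cubeLamS` — the `hrep` text VERBATIM at `Λs := cubeLamS L a M′ ρ′ k k` (the tower boxes of the top layer lie in the window cube: ✓`B8Eq131Cubes.mem_cube_iff`
  + `cube_anti`).  (✓`P1FlatCoreJunction.rep_transl_eq` is the same inverse under the extra premise `transl 0 z ∈ cubeSetM …` — the ROUTE's cube, too small for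
  N05's top layer `Λs k ⊇ D.Om k`.)
* the target `th : XSpace d k 𝔸` with `th (k, yc) = log v₀(W̿₁^{(k)}; y₀, π_k yc)` on `Λs k`, `0` below the top, skew, `‖th‖ ≤ τ` — §2 ★★`exists_topTarget_of_axialT` at
  `M₂(ℂ)`: from the smallness `‖v₀(W̿₁^{(k)}; y₀, π_k yc) − 1‖ ≤ τ∕2` of the axial transporters of the double-bar top average of a unitary-valued, near-`1` field `W₁`
  (✓`P1FlatCoreTopDictionary.exists_topTarget` ∘ ✓`P1FlatCoreFrameLinStar.holT_dbarIterU_mem_unitaryGroup` ∘ ✓`ExpMeanLog.star_mlog_eq_neg` ∘ ✓`MatrixLog.norm_mlog_le_two_mul`),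
  and `norm_axialT_sub_one_lt_one` (= `haxT`).
HONEST SCOPE.  Bookkeeping; the smallness `hsmall` of the axial transporters (J3's pre-gauge sizes ∕ LEAD-H's frame identity) and the windows in `‖th‖` are the
assembler's inputs.  Nothing of [Balaban1985RegularSpaces] Prop. 5 ∕ Sect. E is proved here.

References: T. Bałaban, CMP **99** (1985) 75–102 [Balaban1985RegularSpaces] (p.98, (1.131) p.99, Sect. E (1.91)–(1.92) p.98); CMP **98** (1985) 17–51
[Balaban1985Averaging] (p.24, (23) p.21); CMP **116** (1988) [Balaban1987RG1] ((0.1) p.251); CMP **102** (1985) [Balaban1985UV3∕Variational] ((27) p.263).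
-/

set_option autoImplicit false

noncomputable section

open scoped BigOperators

namespace Summit.QuantumFields.YangMills.Theorems.P1FlatCoreTopTargetRep

open Literature.MathematicalPhysics.QuantumFieldTheory.Balaban1983to89
open T4Continuum MatrixLog
open B15Eq112TorusCover (cover cover_apply lift)
open B14DomainGeom (Pt)
open Node00 (coverAt)
open B7Prop1Local (InBox)
open B8Ineq130 (tlo thi tlo_apply thi_apply)
open B8Eq131Cubes (cube mem_cube_iff cube_anti sqLo sqHi bLo bHi gs)
open B8CubeMemberZd (cubeLamS inBox_sq_of_mem_cubeLamS)
open B5Eq118OneStroke (iterBlockOf)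
open B10Eq27TorusAxialLog (transl transl_apply rel rel_transl_of_mem axialT holT)
open B8Eq1117Concrete (XSpace)
open Summit.QuantumFields.YangMills.Theorems.P1FlatCoreCubeInclusion (kBlock_floor)
open Summit.QuantumFields.YangMills.Theorems.P1FlatCoreTopDictionary (exists_topTarget)

variable {P : Params}

/-! ## §1 The representative inverts the cover on N05's window cube -/

section Rep

/-- **THE LEFT INVERSE ON THE SYMMETRIC WINDOW**: if every coordinate of `z − lift x₀` lies in the half-open symmetric window of the period, then
`lift x₀ + rel x₀ (π z) = z` (✓`rel_transl_of_mem` on `π z = x₀ + (z − lift x₀)`). [cite: Balaban1987RG1, (0.1) p.251; Balaban1985UV3, (27) p.263] -/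
theorem lift_add_rel_cover_eq (x₀ : Site P 0) {z : Pt P.d}
    (hz : ∀ ν, (z ν - lift P x₀ ν) * 2 ∈ Set.Ioc (-(P.sitesPerDir 0 : ℤ)) (P.sitesPerDir 0)) :
    lift P x₀ + rel x₀ (cover P z) = z := by
  have hc : cover P z = transl x₀ (z - lift P x₀) := by
    funext ν
    rw [cover_apply, transl_apply, Pi.sub_apply, Int.cast_sub]
    have h0 : ((lift P x₀ ν : ℤ) : ZMod (P.sitesPerDir 0)) = x₀ ν := by simp [lift]
    rw [h0]
    abel
  rw [hc, rel_transl_of_mem x₀ (z - lift P x₀) (fun ν => hz ν)]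
  abel

/-- ★ **THE DOOR'S REPRESENTATIVE INVERTS THE COVER ON N05's LEVEL-`0` WINDOW CUBE**: with the corner `a` putting `Bᵏx₀` in the top box (`ha`) and the window
fitting twice in the torus (`hroom`, no wrap), `lift x₀ + rel x₀ (π z) = z` for every `z ∈ □₀ = cube L a M′ ρ′ k 0`.
[cite: Balaban1985RegularSpaces, p.98 («we take a size of □ equal to MLʲη»); Balaban1987RG1, (0.1) p.251] -/
theorem rep_cover_eq_of_mem_cube {k : ℕ} (hk : k ≤ P.m + P.K) (x₀ : Site P 0) {a : Pt P.d} {M' ρ' : ℕ}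
    (ha : ∀ ν, a ν ≤ ((iterBlockOf k x₀ ν).val : ℤ) ∧ ((iterBlockOf k x₀ ν).val : ℤ) ≤ a ν + M' - 1)
    (hroom : 2 * (P.L ^ k * (M' + 1) + ρ' * gs P.L k) ≤ P.sitesPerDir 0)
    {z : Pt P.d} (hz : z ∈ cube P.L a M' ρ' k 0) : lift P x₀ + rel x₀ (cover P z) = z := by
  refine lift_add_rel_cover_eq x₀ fun ν => ?_
  have hB := kBlock_floor hk x₀ ν
  obtain ⟨h1, h2⟩ := hz ν
  simp only [B8Ineq130.tlo, B8Ineq130.thi, sqLo, sqHi, bLo, bHi, Nat.sub_zero] at h1 h2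
  push_cast at h1 h2
  have hr : (2 : ℤ) * ((P.L : ℤ) ^ k * ((M' : ℤ) + 1) + (ρ' : ℤ) * (gs P.L k : ℤ)) ≤ (P.sitesPerDir 0 : ℤ) := by exact_mod_cast hroom
  have hq0 : (0 : ℤ) ≤ (P.L : ℤ) ^ k := by positivity
  have ha1 := mul_le_mul_of_nonneg_left (ha ν).1 hq0
  have ha2 := mul_le_mul_of_nonneg_left (ha ν).2 hq0
  refine ⟨?_, ?_⟩
  · nlinarith
  · nlinarith

/-- ★ **`hrep` OF ✓`hFP_kLevel_top_RD` AT N05's TOP LAYER `Λs := cubeLamS L a M′ ρ′ k k`**: every tower box `[L^k yc, L^k(yc+1) − 1]` of a top label `yc ∈ □_k^{(k)}` lies in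
`□₀` (✓`mem_cube_iff` + `cube_anti`), so the door's representative inverts the cover there.
[cite: Balaban1985RegularSpaces, p.98, (1.131) p.99; Balaban1987RG1, (0.1) p.251] -/
theorem hrep_cubeLamS {k : ℕ} (hk : k ≤ P.m + P.K) (x₀ : Site P 0) {a : Pt P.d} {M' ρ' : ℕ}
    (ha : ∀ ν, a ν ≤ ((iterBlockOf k x₀ ν).val : ℤ) ∧ ((iterBlockOf k x₀ ν).val : ℤ) ≤ a ν + M' - 1)
    (hroom : 2 * (P.L ^ k * (M' + 1) + ρ' * gs P.L k) ≤ P.sitesPerDir 0) :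
    ∀ yc ∈ cubeLamS P.L a M' ρ' k k k, ∀ x : Pt P.d, InBox (tlo P.L yc k) (thi P.L yc k) x →
      (fun s => lift P x₀ + rel x₀ s) (cover P x) = x := by
  intro yc hyc x hx
  refine rep_cover_eq_of_mem_cube hk x₀ ha hroom ?_
  have hxk : x ∈ cube P.L a M' ρ' k k :=
    (mem_cube_iff P.L_pos).2 ⟨yc, inBox_sq_of_mem_cubeLamS hyc, fun i => by
      obtain ⟨h1, h2⟩ := hx i
      rw [tlo_apply] at h1
      rw [thi_apply] at h2
      exact ⟨h1, by linarith⟩⟩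
  exact cube_anti (Nat.zero_le k) le_rfl hxk

end Rep

/-! ## §2 The target `th` of the top step from the axial transporters of the double-bar top average -/

section Target

open scoped Matrix.Norms.L2Operator
open Summit.QuantumFields.YangMills.Theorems.Prop8ChartDoubleBar (dbarIterU)
open Summit.QuantumFields.YangMills.Theorems.P1FlatCoreFrameLinStar (holT_dbarIterU_mem_unitaryGroup)
open ExpMeanLog (star_mlog_eq_neg)

/-- **`haxT` OF ✓`hFP_kLevel_top_RD`** from the smallness of the axial transporters: `‖v₀(W̿₁^{(k)}; y₀, π_k yc) − 1‖ ≤ τ∕2 < 1` for `τ ≤ 2∕3`.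
[cite: Balaban1985RegularSpaces, Sect. E (1.91) p.98; Balaban1985Averaging, p.24] -/
theorem norm_axialT_sub_one_lt_one {k : ℕ} (V : GaugeField P k (Matrix (Fin 2) (Fin 2) ℂ)ˣ) (y₀ : Site P k) (Λ : Set (Pt P.d))
    {τ : ℝ} (hτ3 : τ ≤ 2 / 3) (hsmall : ∀ yc ∈ Λ, ‖((axialT V y₀ (coverAt P k yc) : (Matrix (Fin 2) (Fin 2) ℂ)ˣ) : Matrix (Fin 2) (Fin 2) ℂ) - 1‖ ≤ τ / 2) :
    ∀ yc ∈ Λ, ‖((axialT V y₀ (coverAt P k yc) : (Matrix (Fin 2) (Fin 2) ℂ)ˣ) : Matrix (Fin 2) (Fin 2) ℂ) - 1‖ < 1 :=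
  fun yc hyc => (hsmall yc hyc).trans_lt (by linarith)

/-- ★★ **THE TARGET OF THE TOP STEP.**  Fine torus `P`, top level `k ≤ m + K`, a unitary-valued field `W₁` with `‖W₁ − 1‖ ≤ s₀`, `8·3800·((d+2)L)²·Lᵏ·s₀ ≤ 1` (so every
transporter of `W̿₁^{(k)}` is unitary, ✓`holT_dbarIterU_mem_unitaryGroup`), a base point `y₀`, a set `Λ` of top labels and `0 ≤ τ ≤ 2∕3` with
`‖v₀(W̿₁^{(k)}; y₀, π_k yc) − 1‖ ≤ τ∕2` on `Λ`.  Then there is `th : XSpace d k M₂(ℂ)` — the `th, hth, hthk, hthlo` of ✓`hFP_kLevel_top_RD` with the size that enters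
its windows: skew (`th* = −th`), `th (k, yc) = log v₀(W̿₁^{(k)}; y₀, π_k yc)` on `Λ`, `th (j, ·) = 0` for `j < k`, and `‖th‖ ≤ τ` (`‖log X‖ ≤ 2‖X − 1‖`, `(log X)* = −log X`
for unitary `X` near `1`). [cite: Balaban1985RegularSpaces, Sect. E (1.91)-(1.92) p.98; Balaban1985Averaging, (23) p.21, p.24] -/
theorem exists_topTarget_of_axialT {k : ℕ} (hk : k ≤ P.m + P.K) (W₁ : GaugeField P 0 (Matrix (Fin 2) (Fin 2) ℂ)ˣ)
    {s₀ : ℝ} (hs₀ : 0 ≤ s₀) (hbudget : 8 * 3800 * (((P.d + 2) * P.L : ℕ) : ℝ) ^ 2 * (P.L : ℝ) ^ k * s₀ ≤ 1)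
    (hW₁ : ∀ b : PBond P 0, ‖((W₁ b : (Matrix (Fin 2) (Fin 2) ℂ)ˣ) : Matrix (Fin 2) (Fin 2) ℂ) - 1‖ ≤ s₀)
    (hWu : ∀ b : PBond P 0, ((W₁ b : (Matrix (Fin 2) (Fin 2) ℂ)ˣ) : Matrix (Fin 2) (Fin 2) ℂ) ∈ Matrix.unitaryGroup (Fin 2) ℂ)
    (y₀ : Site P k) (Λ : Set (Pt P.d)) {τ : ℝ} (hτ : 0 ≤ τ) (hτ3 : τ ≤ 2 / 3)
    (hsmall : ∀ yc ∈ Λ, ‖((axialT (dbarIterU k W₁) y₀ (coverAt P k yc) : (Matrix (Fin 2) (Fin 2) ℂ)ˣ) : Matrix (Fin 2) (Fin 2) ℂ) - 1‖ ≤ τ / 2) :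
    ∃ th : XSpace P.d k (Matrix (Fin 2) (Fin 2) ℂ),
      (∀ p, star (th p) = -th p) ∧
      (∀ yc ∈ Λ, th (⟨k, Nat.lt_succ_self k⟩, yc) =
        mlog ((axialT (dbarIterU k W₁) y₀ (coverAt P k yc) : (Matrix (Fin 2) (Fin 2) ℂ)ˣ) : Matrix (Fin 2) (Fin 2) ℂ)) ∧
      (∀ (j : ℕ) (hj : j < k) (y : Pt P.d), th (⟨j, Nat.lt_succ_of_lt hj⟩, y) = 0) ∧
      ‖th‖ ≤ τ := by
  have ht : ∀ yc ∈ Λ, ‖mlog ((axialT (dbarIterU k W₁) y₀ (coverAt P k yc) : (Matrix (Fin 2) (Fin 2) ℂ)ˣ) : Matrix (Fin 2) (Fin 2) ℂ)‖ ≤ τ :=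
    fun yc hyc => (norm_mlog_le_two_mul ((hsmall yc hyc).trans (by linarith))).trans (by linarith [hsmall yc hyc])
  have hskew : ∀ yc ∈ Λ, star (mlog ((axialT (dbarIterU k W₁) y₀ (coverAt P k yc) : (Matrix (Fin 2) (Fin 2) ℂ)ˣ) : Matrix (Fin 2) (Fin 2) ℂ)) =
      -mlog ((axialT (dbarIterU k W₁) y₀ (coverAt P k yc) : (Matrix (Fin 2) (Fin 2) ℂ)ˣ) : Matrix (Fin 2) (Fin 2) ℂ) := fun yc hyc =>
    star_mlog_eq_neg (holT_dbarIterU_mem_unitaryGroup hk W₁ hs₀ hbudget hW₁ hWu y₀ _) ((hsmall yc hyc).trans (by linarith))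
  obtain ⟨th, h1, h2, _, h4, h5⟩ := exists_topTarget k Λ
    (fun yc => mlog ((axialT (dbarIterU k W₁) y₀ (coverAt P k yc) : (Matrix (Fin 2) (Fin 2) ℂ)ˣ) : Matrix (Fin 2) (Fin 2) ℂ)) hτ ht
  exact ⟨th, h5 hskew, h1, h2, h4⟩

end Target

end Summit.QuantumFields.YangMills.Theorems.P1FlatCoreTopTargetRep

end
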